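import Summits.QuantumFields.BalabanUV.T4Continuum.Spine.NE2BalabanRoot
import Summits.QuantumFields.BalabanUV.T4Continuum.Support.GaugeTermPerturbationLaw

/-!
# T⁴ programme, spine node NE2 (U1a) — the GAUGE-TERM SLOT of `perturbationLaws_balaban` DISCHARGED BY NAME from row B4.b's END
# (`GaugeTermPerturbationLaw.perturbationLaws_gaugeTerm`, leaf-05): ROOT B for Bałaban's typed tier-B operator with every binder a
# DATA SHAPE of the rows (row B7 part 2, file 3)

NE2 formalisation swarm, leaf prover 08 (row B7).  `Spine/NE2BalabanRoot.perturbationLaws_balaban` left the gauge-term summand as a slot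
`hP₄ : PerturbationLaws (Δ_a ⊗ 1) P₄ (J ⊗ 1) κ₄ (C₄·L^{−k})`.  Row B4.b's END (leaf-05, factorised reading `D_UP_UD_U* = ZᴴNZ` of [B9]
(3.25)–(3.26), owner ruling R5) concludes the target shape for `gaugeTerm = D_UP_UD_Uᴴ − (∂ ⊗ 1)P_1(∂ ⊗ 1)ᴴ` from two `LayerLaws` bundles
of NUMBERS (rows B4.c/B4.d/B4.e/B4.f/B3.a/B5), the `U = 1` unit datum and `n₁·δK < 1`, with a general consistency SEQUENCE `EGT … k`.
Here:
 * §1 geometric number sequences give a geometric `EGT`: `zetaL_le_geom`, `epsL_le_geom`, `nuL_le_geom`, **`EGT_le_geom`** (constant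
   **`C4GT`**, explicit, OURS) — so the END meets the slot's `C₄·L^{−k}` form (`perturbationLaws_gaugeTerm_geom`);
 * §2 the B4 summand of `Δ_a(U) − Δ_a(1) ⊗ 1` carries a MINUS sign (`Δ_a = Δ + DRD* + Q*aQ`, `R = 1 − P`; the `DD*` part sits in row B2's
   rough Laplacian — leaf-05's interface note): **`gaugeSlot = −gaugeTerm`**, `perturbationLaws_neg`, **`perturbationLaws_gaugeSlot`**;
 * §3 **`perturbationLaws_balaban_gauge`** = `perturbationLaws_balaban` with `hP₄ := perturbationLaws_gaugeSlot`: the target shape for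
   `balabanPert R (gaugeSlot …)` — Bałaban's typed tier-B operator with ALL THREE summands typed — whose displayed binders are now ONLY
   data shapes of the rows: `hreg` (B5), `hNE3` (NE3 on `{w, Dw}`), `hE` (Ecov's transport-error laws, B3.a′ (iii)/B3.b-conc), the two
   `LayerLaws` + unit datum + `n₁δK < 1` + geometric number bounds (B4.b–B4.f); and **`balaban_gauge_rate_of_small`** (t = 1 under the
   explicit threshold `η·K⋆ < 1` of `NE2BalabanRoot`).

HONEST FRAMING (T4-DAG p. 1).  Assembly + elementary inequalities; MODEL LEVEL (transporters `R`, scalar averagings `Q_U, Q_1`, plantings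
`J₀`, all numbers are DATA / hypothesis shapes — no assertion that they are Bałaban's `U_k(V)`, `Q′(U_k)`; no B0, c5); CONDITIONAL on node NE3
(c2/c7), the regularity class (c3) and the rows' data as displayed (c4); carver's ruling c1 stands; NOT [B9] (3.23)–(3.26) as printed; **NE2
NOT PROVED**; NOT infinite volume, NOT a mass gap, NOT Clay, NOT summit progress; spine 0/9 unchanged.  HONEST DEPENDENCY: continuum YM on T⁴
⇐ BetaPertH ∧ nine spine estimates (0/9 proved); BetaPertH ⇐ (D1) ∧ (D4) ∧ CAP+tail; G-an2-4 gates asym, D1 and NE2/3/4.  ABSOLUTE RULE kept;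
no `sorry`.
-/

noncomputable section

open scoped BigOperators ComplexConjugate Matrix Matrix.Norms.L2Operator Kronecker
open Filter Topology

namespace Summit.QuantumFields.BalabanUV.T4Continuum.NE2BalabanGauge

open Literature.MathematicalPhysics.QuantumFieldTheory.Balaban1983to89.B5Prop11Plancherel (Cst Cst_nonneg Tor fine)
open Literature.MathematicalPhysics.QuantumFieldTheory.Balaban1983to89.B5G183RateUnitTower (lev lev_neZero)
open Literature.MathematicalPhysics.QuantumFieldTheory.Balaban1983to89.T4EtaRateMin (LocalRate)
open Summit.QuantumFields.BalabanUV.T4Continuum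
open Summit.QuantumFields.BalabanUV.T4Continuum.CovariantAveragingTower (TowerLimitRate)
open Summit.QuantumFields.BalabanUV.T4Continuum.BalabanAveragedTowerUnit (idx Qlev)
open Summit.QuantumFields.BalabanUV.T4Continuum.BackgroundResolventTower
open Summit.QuantumFields.BalabanUV.T4Continuum.KingPairingPlantedLaw
open Summit.QuantumFields.BalabanUV.T4Continuum.PerturbationAlgebra
open Summit.QuantumFields.BalabanUV.T4Continuum.GramPerturbationLaw (AveragingLaws C2gram)
open Summit.QuantumFields.BalabanUV.T4Continuum.NE2FromNE3 (bgReadings)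
open Summit.QuantumFields.BalabanUV.T4Continuum.RegularBackgroundTower (RegularTransporters regClass)
open Summit.QuantumFields.BalabanUV.T4Continuum.CovariantBlockAveraging (Ecov)
open Summit.QuantumFields.BalabanUV.T4Continuum.CovariantAveragingSummand (kappaQ)
open Summit.QuantumFields.BalabanUV.T4Continuum.GaugeTermSandwichLaw
open Summit.QuantumFields.BalabanUV.T4Continuum.GaugeTermLayer
open Summit.QuantumFields.BalabanUV.T4Continuum.GaugeTermPerturbationLaw
open Summit.QuantumFields.BalabanUV.T4Continuum.NE2BalabanLayer
open Summit.QuantumFields.BalabanUV.T4Continuum.NE2BalabanRoot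

/-! ## §1 Geometric number sequences give a geometric `EGT` -/

section Geom

variable {d : ℕ} {a g q α nK : ℝ} {es ec θ q₁ : ℕ → ℝ} {ρ Ces Cec Cθ Cq : ℝ}

/-- the geometric constant of `zetaL`. [folklore] -/
def CzetaL (d : ℕ) (a g q α Ces Cθ Cq : ℝ) : ℝ := q * Cθ + q * Ces * ((d + α) * Cst d a) + Cq * Real.sqrt g * Cst d a

/-- the geometric constant of `epsL`. [folklore] -/
def CepsL (g q Ces Cq : ℝ) : ℝ := q * Ces + Cq * g

/-- the geometric constant of `nuL`. [folklore] -/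
def CnuL (g q nK Ces Cec Cq : ℝ) : ℝ :=
  nK * (2 * (q * g) * CepsL g q Ces Cq + CepsL g q Ces Cq * CepsL g q Ces Cq + q * Cec * (q * g)) * nK

/-- `zetaL ≤ CzetaL·ρ^k` for geometric `es, θ, q₁` (`q, α ≥ 0`). [folklore] -/
theorem zetaL_le_geom (hq : 0 ≤ q) (hα : 0 ≤ α) (hes : ∀ k, es k ≤ Ces * ρ ^ k) (hθ : ∀ k, θ k ≤ Cθ * ρ ^ k)
    (hq₁ : ∀ k, q₁ k ≤ Cq * ρ ^ k) (k : ℕ) : zetaL d a g q α es θ q₁ k ≤ CzetaL d a g q α Ces Cθ Cq * ρ ^ k := by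
  have hC := Cst_nonneg d a
  have hsg := Real.sqrt_nonneg g
  have hdα : 0 ≤ (d + α) * Cst d a := by positivity
  have h1 := mul_le_mul_of_nonneg_left (hθ k) hq
  have h2 := mul_le_mul_of_nonneg_right (mul_le_mul_of_nonneg_left (hes k) hq) hdα
  have h3 := mul_le_mul_of_nonneg_right (mul_le_mul_of_nonneg_right (hq₁ k) hsg) hC
  unfold zetaL CzetaL
  nlinarith [h1, h2, h3]

/-- `epsL ≤ CepsL·ρ^k` (`q, g ≥ 0`). [folklore] -/
theorem epsL_le_geom (hq : 0 ≤ q) (hg : 0 ≤ g) (hes : ∀ k, es k ≤ Ces * ρ ^ k) (hq₁ : ∀ k, q₁ k ≤ Cq * ρ ^ k) (k : ℕ) :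
    epsL g q es q₁ k ≤ CepsL g q Ces Cq * ρ ^ k := by
  have h1 := mul_le_mul_of_nonneg_left (hes k) hq
  have h2 := mul_le_mul_of_nonneg_right (hq₁ k) hg
  unfold epsL CepsL
  nlinarith [h1, h2]

/-- `0 ≤ epsL` when `es, q₁ ≥ 0` (`q, g ≥ 0`). [folklore] -/
theorem epsL_nonneg (hq : 0 ≤ q) (hg : 0 ≤ g) (hes0 : ∀ k, 0 ≤ es k) (hq0 : ∀ k, 0 ≤ q₁ k) (k : ℕ) : 0 ≤ epsL g q es q₁ k := by
  unfold epsL; have := hes0 k; have := hq0 k; positivity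

/-- `nuL ≤ CnuL·ρ^k` for geometric `es, ec, q₁ ≥ 0` and `0 ≤ ρ ≤ 1` (the quadratic term uses `ρ^{2k} ≤ ρ^k`). [folklore] -/
theorem nuL_le_geom (hq : 0 ≤ q) (hg : 0 ≤ g) (hnK : 0 ≤ nK) (hρ0 : 0 ≤ ρ) (hρ1 : ρ ≤ 1) (hes0 : ∀ k, 0 ≤ es k) (hq0 : ∀ k, 0 ≤ q₁ k)
    (hec0 : ∀ k, 0 ≤ ec k) (hes : ∀ k, es k ≤ Ces * ρ ^ k) (hec : ∀ k, ec k ≤ Cec * ρ ^ k) (hq₁ : ∀ k, q₁ k ≤ Cq * ρ ^ k) (k : ℕ) :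
    nuL g q nK es ec q₁ k ≤ CnuL g q nK Ces Cec Cq * ρ ^ k := by
  have hρk : ρ ^ k ≤ 1 := pow_le_one₀ hρ0 hρ1
  have hρk0 : 0 ≤ ρ ^ k := pow_nonneg hρ0 k
  have hε := epsL_le_geom hq hg hes hq₁ k
  have hε0 := epsL_nonneg hq hg hes0 hq0 k
  have hCε0 : 0 ≤ CepsL g q Ces Cq * ρ ^ k := hε0.trans hε
  have hsq : epsL g q es q₁ k * epsL g q es q₁ k ≤ CepsL g q Ces Cq * CepsL g q Ces Cq * ρ ^ k := by
    calc epsL g q es q₁ k * epsL g q es q₁ k ≤ (CepsL g q Ces Cq * ρ ^ k) * (CepsL g q Ces Cq * ρ ^ k) := mul_le_mul hε hε hε0 hCε0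
      _ = (CepsL g q Ces Cq * CepsL g q Ces Cq * ρ ^ k) * ρ ^ k := by ring
      _ ≤ (CepsL g q Ces Cq * CepsL g q Ces Cq * ρ ^ k) * 1 := by
          refine mul_le_mul_of_nonneg_left hρk ?_
          have : 0 ≤ (CepsL g q Ces Cq * ρ ^ k) * (CepsL g q Ces Cq * ρ ^ k) := mul_nonneg hCε0 hCε0
          rcases eq_or_lt_of_le hρk0 with h0 | hpos
          · rw [← h0]; simp
          · nlinarith [this]
      _ = CepsL g q Ces Cq * CepsL g q Ces Cq * ρ ^ k := mul_one _
  have hqg : 0 ≤ q * g := mul_nonneg hq hg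
  have h1 : 2 * (q * g) * epsL g q es q₁ k ≤ 2 * (q * g) * (CepsL g q Ces Cq * ρ ^ k) := mul_le_mul_of_nonneg_left hε (by positivity)
  have h3 : q * ec k * (q * g) ≤ q * (Cec * ρ ^ k) * (q * g) := mul_le_mul_of_nonneg_right (mul_le_mul_of_nonneg_left (hec k) hq) hqg
  have hinner : 2 * (q * g) * epsL g q es q₁ k + epsL g q es q₁ k * epsL g q es q₁ k + q * ec k * (q * g)
      ≤ (2 * (q * g) * CepsL g q Ces Cq + CepsL g q Ces Cq * CepsL g q Ces Cq + q * Cec * (q * g)) * ρ ^ k := by nlinarith [h1, hsq, h3]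
  have hinner0 : 0 ≤ 2 * (q * g) * epsL g q es q₁ k + epsL g q es q₁ k * epsL g q es q₁ k + q * ec k * (q * g) := by
    have := hec0 k; positivity
  unfold nuL CnuL
  have := mul_le_mul_of_nonneg_left hinner hnK
  have := mul_le_mul_of_nonneg_right this hnK
  calc nK * (2 * (q * g) * epsL g q es q₁ k + epsL g q es q₁ k * epsL g q es q₁ k + q * ec k * (q * g)) * nK
      ≤ nK * ((2 * (q * g) * CepsL g q Ces Cq + CepsL g q Ces Cq * CepsL g q Ces Cq + q * Cec * (q * g)) * ρ ^ k) * nK := this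
    _ = nK * (2 * (q * g) * CepsL g q Ces Cq + CepsL g q Ces Cq * CepsL g q Ces Cq + q * Cec * (q * g)) * nK * ρ ^ k := by ring

end Geom

section GeomEGT

variable {d L : ℕ} {a g q α τ a' n₁ : ℝ} {esu ecu θu q₁u es₁ ec₁ θ₁ q₁₁ : ℕ → ℝ}

/-- the geometric constant of ONE family's `Esand` on the lifted King tower (`z = q√g`, unit-layer bound `n`). [folklore] -/
def C4one (d : ℕ) (a g q n Cζ Cν : ℝ) : ℝ :=
  Cst d a * (q * Real.sqrt g) * n * (2 * Cζ + (q * Real.sqrt g) * (2 * CJ d a + 2 * d * Cst d a))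
    + Cst d a * Cst d a * (q * Real.sqrt g) * (q * Real.sqrt g) * Cν

/-- **the geometric constant of `EGT`**: both families' `C4one` with `n = n₁(1 − n₁δK)⁻¹`, `Cζ = CzetaL`, `Cν = CnuL`. [folklore] -/
def C4GT (d : ℕ) (a g q α τ a' n₁ Cesu Cecu Cθu Cqu Ces₁ Cec₁ Cθ₁ Cq₁ : ℝ) : ℝ :=
  C4one d a g q (n₁ * (1 - n₁ * deltaK g q α τ a')⁻¹) (CzetaL d a g q α Cesu Cθu Cqu)
      (CnuL g q (n₁ * (1 - n₁ * deltaK g q α τ a')⁻¹) Cesu Cecu Cqu)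
    + C4one d a g q (n₁ * (1 - n₁ * deltaK g q α τ a')⁻¹) (CzetaL d a g q α Ces₁ Cθ₁ Cq₁)
      (CnuL g q (n₁ * (1 - n₁ * deltaK g q α τ a')⁻¹) Ces₁ Cec₁ Cq₁)

/-- the bundle of GEOMETRIC BOUNDS (ratio `L⁻¹`) on one family's four number sequences of `LayerLaws`, with their nonnegativity.
A hypothesis shape on data (row B4.b's suppliers B4.c–B4.f deliver such bounds); asserted by nobody. [folklore] -/
structure GeomNumbers (L : ℕ) (es ec θ q₁ : ℕ → ℝ) (Ces Cec Cθ Cq : ℝ) : Prop where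
  es_nonneg : ∀ k, 0 ≤ es k
  ec_nonneg : ∀ k, 0 ≤ ec k
  q₁_nonneg : ∀ k, 0 ≤ q₁ k
  es_le : ∀ k, es k ≤ Ces * ((L : ℝ)⁻¹) ^ k
  ec_le : ∀ k, ec k ≤ Cec * ((L : ℝ)⁻¹) ^ k
  θ_le : ∀ k, θ k ≤ Cθ * ((L : ℝ)⁻¹) ^ k
  q₁_le : ∀ k, q₁ k ≤ Cq * ((L : ℝ)⁻¹) ^ k

/-- **`EGT ≤ C4GT·L^{−k}`** for `L ≥ 1`, nonnegative sizes and geometric numbers of both families. [folklore] -/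
theorem EGT_le_geom (hL : 1 ≤ L) (hq : 0 ≤ q) (hg : 0 ≤ g) (hα : 0 ≤ α) (hn : 0 ≤ n₁ * (1 - n₁ * deltaK g q α τ a')⁻¹)
    {Cesu Cecu Cθu Cqu Ces₁ Cec₁ Cθ₁ Cq₁ : ℝ} (hGu : GeomNumbers L esu ecu θu q₁u Cesu Cecu Cθu Cqu)
    (hG₁ : GeomNumbers L es₁ ec₁ θ₁ q₁₁ Ces₁ Cec₁ Cθ₁ Cq₁) (k : ℕ) :
    EGT d L a g q α τ a' n₁ esu ecu θu q₁u es₁ ec₁ θ₁ q₁₁ k ≤ C4GT d a g q α τ a' n₁ Cesu Cecu Cθu Cqu Ces₁ Cec₁ Cθ₁ Cq₁ * ((L : ℝ)⁻¹) ^ k := by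
  have hρ0 : (0 : ℝ) ≤ (L : ℝ)⁻¹ := inv_nonneg.mpr (Nat.cast_nonneg _)
  have hρ1 : (L : ℝ)⁻¹ ≤ 1 := inv_le_one_of_one_le₀ (by exact_mod_cast hL)
  have hC := Cst_nonneg d a
  have hz : 0 ≤ q * Real.sqrt g := mul_nonneg hq (Real.sqrt_nonneg g)
  have eu := Esand_le_geometric (e₀ := fun k => 2 * d * Cst d a * ((L : ℝ)⁻¹) ^ k) (e₁ := fun k => CJ d a * ((L : ℝ)⁻¹) ^ k)
    hC hz hn (ζ := zetaL d a g q α esu θu q₁u) (ν := nuL g q (n₁ * (1 - n₁ * deltaK g q α τ a')⁻¹) esu ecu q₁u)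
    (ρ := (L : ℝ)⁻¹) (C₀ := 2 * d * Cst d a) (C₁ := CJ d a) (Cζ := CzetaL d a g q α Cesu Cθu Cqu)
    (Cν := CnuL g q (n₁ * (1 - n₁ * deltaK g q α τ a')⁻¹) Cesu Cecu Cqu) (fun k => le_rfl) (fun k => le_rfl)
    (zetaL_le_geom (d := d) (a := a) (g := g) hq hα hGu.es_le hGu.θ_le hGu.q₁_le)
    (nuL_le_geom hq hg hn hρ0 hρ1 hGu.es_nonneg hGu.q₁_nonneg hGu.ec_nonneg hGu.es_le hGu.ec_le hGu.q₁_le) k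
  have e1 := Esand_le_geometric (e₀ := fun k => 2 * d * Cst d a * ((L : ℝ)⁻¹) ^ k) (e₁ := fun k => CJ d a * ((L : ℝ)⁻¹) ^ k)
    hC hz hn (ζ := zetaL d a g q α es₁ θ₁ q₁₁) (ν := nuL g q (n₁ * (1 - n₁ * deltaK g q α τ a')⁻¹) es₁ ec₁ q₁₁)
    (ρ := (L : ℝ)⁻¹) (C₀ := 2 * d * Cst d a) (C₁ := CJ d a) (Cζ := CzetaL d a g q α Ces₁ Cθ₁ Cq₁)
    (Cν := CnuL g q (n₁ * (1 - n₁ * deltaK g q α τ a')⁻¹) Ces₁ Cec₁ Cq₁) (fun k => le_rfl) (fun k => le_rfl)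
    (zetaL_le_geom (d := d) (a := a) (g := g) hq hα hG₁.es_le hG₁.θ_le hG₁.q₁_le)
    (nuL_le_geom hq hg hn hρ0 hρ1 hG₁.es_nonneg hG₁.q₁_nonneg hG₁.ec_nonneg hG₁.es_le hG₁.ec_le hG₁.q₁_le) k
  unfold EGT C4GT C4one
  refine (add_le_add eu e1).trans (le_of_eq ?_)
  ring

end GeomEGT

/-! ## §2 The gauge slot `−gaugeTerm` and its `PerturbationLaws` in the slot form -/

section Slot

variable {ι : ℕ → Type*} [∀ k, Fintype (ι k)] [∀ k, DecidableEq (ι k)]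
variable {D : (k : ℕ) → Matrix (ι k) (ι k) ℂ} {J : (k : ℕ) → Matrix (ι (k + 1)) (ι k) ℂ}

/-- negation keeps the target shape's constants. [folklore] -/
theorem perturbationLaws_neg {P : (k : ℕ) → Matrix (ι k) (ι k) ℂ} {κ : ℝ} {e : ℕ → ℝ} (h : PerturbationLaws D P J κ e) :
    PerturbationLaws D (fun k => -P k) J κ e where
  opNorm_P_mul_inv_le := fun k => by rw [Matrix.neg_mul, norm_neg]; exact h.opNorm_P_mul_inv_le k
  opNorm_inv_mul_P_le := fun k => by rw [Matrix.mul_neg, norm_neg]; exact h.opNorm_inv_mul_P_le k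
  consistent_le := fun k => by
    have hneg : -P (k + 1) * J k - J k * -P k = -(P (k + 1) * J k - J k * P k) := by
      rw [Matrix.neg_mul, Matrix.mul_neg]; abel
    show ‖(D (k + 1))⁻¹ * (-P (k + 1) * J k - J k * -P k) * (D k)⁻¹‖ ≤ e k
    rw [hneg, Matrix.mul_neg, Matrix.neg_mul, norm_neg]
    exact h.consistent_le k

end Slot

variable {d : ℕ} (L : ℕ) [NeZero L] (M : Fin d → ℕ) [hM : ∀ μ, NeZero (M μ)] (a : ℝ) (ha : 0 < a)
variable {o : Type*} [Fintype o] [DecidableEq o] {γ : Type*} [Fintype γ] [DecidableEq γ]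

/-- **THE GAUGE SLOT** `P₄,k = −(D_kP_{U,k}D_kᴴ − (∂ ⊗ 1)P_{1,k}(∂ ⊗ 1)ᴴ)` — the B4 summand of the model of `Δ_a(U) − Δ_a(1) ⊗ 1` with its
sign (`Δ_a = Δ + DRD* + Q*aQ`, `R = 1 − P`; [B9] (3.26) p.395, (3.25) p.394 shapes). [cite: Balaban1985BackgroundPropagators, (3.25) p.394,
(3.26) p.395 (shapes)] [folklore] -/
def gaugeSlot (R : (k : ℕ) → Fin d → (Tor (fine (lev L k) M) → Matrix o o ℂ)) (Qu Q₁ : (k : ℕ) → Matrix γ (Tor (fine (lev L k) M) × o) ℂ)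
    (a' : ℝ) (k : ℕ) : Matrix (idx L M k × o) (idx L M k × o) ℂ :=
  -(gaugeTerm L M R Qu Q₁ a' k)

/-- **ROW B4.b's END IN THE SLOT FORM**: two `LayerLaws`, the transport size `τ`, the `U = 1` unit datum, `n₁δK < 1` and GEOMETRIC numbers
give the target shape for `gaugeSlot` with `κ₄ = kappaGT …`, `C₄ = C4GT …`. [folklore] -/
theorem perturbationLaws_gaugeSlot {R : (k : ℕ) → Fin d → (Tor (fine (lev L k) M) → Matrix o o ℂ)}
    {Qu Q₁ : (k : ℕ) → Matrix γ (Tor (fine (lev L k) M) × o) ℂ} {a' : ℝ}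
    {J₀ : (k : ℕ) → Matrix (Tor (fine (lev L (k + 1)) M) × o) (Tor (fine (lev L k) M) × o) ℂ}
    {g q α τ n₁ : ℝ} {esu ecu θu q₁u es₁ ec₁ θ₁ q₁₁ : ℕ → ℝ} {Cesu Cecu Cθu Cqu Ces₁ Cec₁ Cθ₁ Cq₁ : ℝ}
    (hu : LayerLaws L M a ha R Qu a' J₀ g q α esu ecu θu q₁u) (h₁ : LayerLaws L M a ha (oneR L M (o := o)) Q₁ a' J₀ g q α es₁ ec₁ θ₁ q₁₁)
    (hτ : ∀ k, ‖Qu k - Q₁ k‖ ≤ τ)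
    (hK₁ : ∀ k, IsUnit (Q₁ k * Gop L M (oneR L M (o := o)) Q₁ a' k * Gop L M (oneR L M (o := o)) Q₁ a' k * (Q₁ k)ᴴ).det)
    (hn₁ : ∀ k, ‖Nt L M (oneR L M (o := o)) Q₁ a' k‖ ≤ n₁) (hsmall : n₁ * deltaK g q α τ a' < 1)
    (hGu : GeomNumbers L esu ecu θu q₁u Cesu Cecu Cθu Cqu) (hG₁ : GeomNumbers L es₁ ec₁ θ₁ q₁₁ Ces₁ Cec₁ Cθ₁ Cq₁) :
    PerturbationLaws (fun k => calDalev L M a ha k ⊗ₖ (1 : Matrix o o ℂ)) (gaugeSlot L M R Qu Q₁ a')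
      (fun k => JpcT L M k ⊗ₖ (1 : Matrix o o ℂ)) (kappaGT d a g q α τ a' n₁)
      (fun k => C4GT d a g q α τ a' n₁ Cesu Cecu Cθu Cqu Ces₁ Cec₁ Cθ₁ Cq₁ * ((L : ℝ)⁻¹) ^ k) := by
  have hL1 : 1 ≤ L := Nat.pos_of_ne_zero (NeZero.ne L)
  have h := perturbationLaws_gaugeTerm L M a ha R Qu Q₁ a' J₀ hu h₁ hτ hK₁ hn₁ hsmall
  have hn₁0 : 0 ≤ n₁ := (norm_nonneg _).trans (hn₁ 0)
  have hδ0 : 0 ≤ n₁ * deltaK g q α τ a' := mul_nonneg hn₁0 ((norm_nonneg _).trans (opNorm_gramK_U_sub_le hu h₁ hτ 0))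
  have hn : 0 ≤ n₁ * (1 - n₁ * deltaK g q α τ a')⁻¹ := mul_nonneg hn₁0 (inv_nonneg.mpr (by linarith))
  have hg : 0 ≤ g := (norm_nonneg _).trans (hu.opNorm_G_le 0)
  exact perturbationLaws_neg (perturbationLaws_mono h le_rfl
    (EGT_le_geom hL1 hu.nonneg.2.1 hg hu.nonneg.2.2 hn hGu hG₁))

/-! ## §3 `perturbationLaws_balaban` with the gauge slot discharged: every binder a data shape of the rows -/

/-- the 1-form-indexed transporter tower of rows B2/B3/B5 read off SITE-based bond transporters `Rg k ν x` (row B4's data), level by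
level through leaf-10's `GaugeTermDecomposition.liftR`: the transporter for direction `ν` at the index `(x, μ)` is `Rg k ν x`
(component-blind). [folklore] -/
def liftR (Rg : (k : ℕ) → Fin d → (Tor (fine (lev L k) M) → Matrix o o ℂ)) : (k : ℕ) → Fin d → (idx L M k → Matrix o o ℂ) :=
  fun k => GaugeTermDecomposition.liftR (fine (lev L k) M) (Rg k)

omit [NeZero L] hM [Fintype o] [DecidableEq o] in
/-- entries of the lifted tower. [folklore] -/
theorem liftR_apply (Rg : (k : ℕ) → Fin d → (Tor (fine (lev L k) M) → Matrix o o ℂ)) (k : ℕ) (ν : Fin d) (i : idx L M k) :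
    liftR L M Rg k ν i = Rg k ν i.1 := rfl

/-- **THE TIER-B LAW FOR BAŁABAN's TYPED OPERATOR WITH ALL THREE SUMMANDS TYPED**, ONE background: site-based bond transporters `Rg` feed
row B4 directly and rows B2/B3/B5 through `liftR Rg` — `balabanPert (liftR Rg) (gaugeSlot Rg Q_U Q_1 a′) =
(Δ^{R} − Δ^1 ⊗ 1) + a·n^d(Q(R)ᴴQ(R) − QᴴQ ⊗ 1) − (D_RP_UD_Rᴴ − (∂⊗1)P_1(∂⊗1)ᴴ)`.  Displayed binders, all DATA SHAPES of the rows: `hreg` (B5),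
`hNE3` (node NE3 BY NAME on `{w, Dw}`), `hE` (Ecov's transport-error laws, rows B3.a′ (iii)/B3.b-conc), `hu h₁ hτ hK₁ hn₁ hsmall hGu hG₁`
(row B4.b with its suppliers B4.c–B4.f).  NE2 is NOT proved by this. [cite: Balaban1985BackgroundPropagators, (3.26) p.395 (shape)] [folklore] -/
theorem perturbationLaws_balaban_gauge (hd : 1 ≤ d) {Rg : (k : ℕ) → Fin d → (Tor (fine (lev L k) M) → Matrix o o ℂ)} {α₅ β : ℝ}
    (hreg : RegularTransporters L M (liftR L M Rg) α₅ β) {C : ℝ} (hC : 0 ≤ C)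
    (hNE3 : LocalRate (bgReadings L M (regClass L M (liftR L M Rg))) C ((L : ℝ)⁻¹)) {ε Cδ : ℝ} (hε : 0 ≤ ε)
    (hE : AveragingLaws (fun k => calDalev L M a ha k ⊗ₖ (1 : Matrix o o ℂ)) (Ecov L M (liftR L M Rg))
      (fun k => JpcT L M k ⊗ₖ (1 : Matrix o o ℂ)) ε (fun k => Cδ * ((L : ℝ)⁻¹) ^ k))
    {Qu Q₁ : (k : ℕ) → Matrix γ (Tor (fine (lev L k) M) × o) ℂ} {a' : ℝ}
    {J₀ : (k : ℕ) → Matrix (Tor (fine (lev L (k + 1)) M) × o) (Tor (fine (lev L k) M) × o) ℂ}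
    {g q α τ n₁ : ℝ} {esu ecu θu q₁u es₁ ec₁ θ₁ q₁₁ : ℕ → ℝ} {Cesu Cecu Cθu Cqu Ces₁ Cec₁ Cθ₁ Cq₁ : ℝ}
    (hu : LayerLaws L M a ha Rg Qu a' J₀ g q α esu ecu θu q₁u) (h₁ : LayerLaws L M a ha (oneR L M (o := o)) Q₁ a' J₀ g q α es₁ ec₁ θ₁ q₁₁)
    (hτ : ∀ k, ‖Qu k - Q₁ k‖ ≤ τ)
    (hK₁ : ∀ k, IsUnit (Q₁ k * Gop L M (oneR L M (o := o)) Q₁ a' k * Gop L M (oneR L M (o := o)) Q₁ a' k * (Q₁ k)ᴴ).det)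
    (hn₁ : ∀ k, ‖Nt L M (oneR L M (o := o)) Q₁ a' k‖ ≤ n₁) (hsmall : n₁ * deltaK g q α τ a' < 1)
    (hGu : GeomNumbers L esu ecu θu q₁u Cesu Cecu Cθu Cqu) (hG₁ : GeomNumbers L es₁ ec₁ θ₁ q₁₁ Ces₁ Cec₁ Cθ₁ Cq₁) :
    PerturbationLaws (fun k => calDalev L M a ha k ⊗ₖ (1 : Matrix o o ℂ)) (balabanPert L M a (liftR L M Rg) (gaugeSlot L M Rg Qu Q₁ a'))
      (fun k => JpcT L M k ⊗ₖ (1 : Matrix o o ℂ)) (kappaB o d a α₅ β C (kappaQ d a (a : ℂ) ε) (kappaGT d a g q α τ a' n₁))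
      (fun k => C2B o d L a α₅ β C (a * C2gram (Cst d a) 1 ε (2 * d * Cst d a) (CJ d a) (Cst d a) Cδ)
        (C4GT d a g q α τ a' n₁ Cesu Cecu Cθu Cqu Ces₁ Cec₁ Cθ₁ Cq₁) * ((L : ℝ)⁻¹) ^ k) :=
  perturbationLaws_balaban L M a ha hd hreg hC hNE3 hε hE
    (perturbationLaws_gaugeSlot L M a ha hu h₁ hτ hK₁ hn₁ hsmall hGu hG₁)

/-- **ROOT B AT `t = 1` FOR BAŁABAN's TYPED OPERATOR, EXPLICIT THRESHOLD** (`L ≥ 2`, `d ≥ 1`): all smallness data `α₅, β, C, ε, κ₄ ≤ η ≤ 1`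
(`κ₄ = kappaGT …` of the gauge term) and `η·K⋆(card o, d, a) < 1` ⟹ the lifted King-averaged unit-lattice covariances of
`(Δ_a^{(k)} ⊗ 1 + P_k)⁻¹` CONVERGE with rate `L^{−k}` — CONDITIONAL on node NE3, the regularity class, Ecov's laws and row B4.b's data, all
displayed.  NE2 is NOT proved by this. [folklore] -/
theorem balaban_gauge_rate_of_small (hL : 2 ≤ L) (hd : 1 ≤ d) {Rg : (k : ℕ) → Fin d → (Tor (fine (lev L k) M) → Matrix o o ℂ)}
    {α₅ β : ℝ} (hreg : RegularTransporters L M (liftR L M Rg) α₅ β) {C : ℝ} (hC : 0 ≤ C)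
    (hNE3 : LocalRate (bgReadings L M (regClass L M (liftR L M Rg))) C ((L : ℝ)⁻¹)) {ε Cδ : ℝ} (hε : 0 ≤ ε)
    (hE : AveragingLaws (fun k => calDalev L M a ha k ⊗ₖ (1 : Matrix o o ℂ)) (Ecov L M (liftR L M Rg))
      (fun k => JpcT L M k ⊗ₖ (1 : Matrix o o ℂ)) ε (fun k => Cδ * ((L : ℝ)⁻¹) ^ k))
    {Qu Q₁ : (k : ℕ) → Matrix γ (Tor (fine (lev L k) M) × o) ℂ} {a' : ℝ}
    {J₀ : (k : ℕ) → Matrix (Tor (fine (lev L (k + 1)) M) × o) (Tor (fine (lev L k) M) × o) ℂ}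
    {g q α τ n₁ : ℝ} {esu ecu θu q₁u es₁ ec₁ θ₁ q₁₁ : ℕ → ℝ} {Cesu Cecu Cθu Cqu Ces₁ Cec₁ Cθ₁ Cq₁ : ℝ}
    (hu : LayerLaws L M a ha Rg Qu a' J₀ g q α esu ecu θu q₁u) (h₁ : LayerLaws L M a ha (oneR L M (o := o)) Q₁ a' J₀ g q α es₁ ec₁ θ₁ q₁₁)
    (hτ : ∀ k, ‖Qu k - Q₁ k‖ ≤ τ)
    (hK₁ : ∀ k, IsUnit (Q₁ k * Gop L M (oneR L M (o := o)) Q₁ a' k * Gop L M (oneR L M (o := o)) Q₁ a' k * (Q₁ k)ᴴ).det)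
    (hn₁ : ∀ k, ‖Nt L M (oneR L M (o := o)) Q₁ a' k‖ ≤ n₁) (hsmall : n₁ * deltaK g q α τ a' < 1)
    (hGu : GeomNumbers L esu ecu θu q₁u Cesu Cecu Cθu Cqu) (hG₁ : GeomNumbers L es₁ ec₁ θ₁ q₁₁ Ces₁ Cec₁ Cθ₁ Cq₁)
    {η : ℝ} (hαη : α₅ ≤ η) (hβη : β ≤ η) (hCη : C ≤ η) (hεη : ε ≤ η) (hκη : kappaGT d a g q α τ a' n₁ ≤ η) (hη1 : η ≤ 1)
    (hηK : η * Kstar o d a < 1) :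
    TowerLimitRate (fun k => Qlev L M k ⊗ₖ (1 : Matrix o o ℂ)) ((L : ℝ) ^ d)
      (fun k => (calDalev L M a ha k ⊗ₖ (1 : Matrix o o ℂ) + balabanPert L M a (liftR L M Rg) (gaugeSlot L M Rg Qu Q₁ a') k)⁻¹)
      (Cpert (kappaB o d a α₅ β C (a * (ε * (2 + ε) * Cst d a)) (kappaGT d a g q α τ a' n₁)) (2 * d * Cst d a) (CJ d a)
        (C2B o d L a α₅ β C (a * C2gram (Cst d a) 1 ε (2 * d * Cst d a) (CJ d a) (Cst d a) Cδ)
          (C4GT d a g q α τ a' n₁ Cesu Cecu Cθu Cqu Ces₁ Cec₁ Cθ₁ Cq₁)) 0 1) ((L : ℝ)⁻¹) :=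
  balaban_rate_of_small L M a ha hL hd hreg hC hNE3 hε hE (perturbationLaws_gaugeSlot L M a ha hu h₁ hτ hK₁ hn₁ hsmall hGu hG₁)
    hαη hβη hCη hεη hκη hη1 hηK

end Summit.QuantumFields.BalabanUV.T4Continuum.NE2BalabanGauge

end
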